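import Literature.MathematicalPhysics.QuantumFieldTheory.YangMillsOS
import Literature.Analysis.Calculus.ClosedSubgroupExpChart
import HarnessLib

/-!
# Stub `stub_liePos` for line Sketch of crux `EquipartitionPinsProbe`

For a compact simple Lie group `G` (tree `IsCompactSimpleLieGroup G`: connected, non-abelian, with
a faithful continuous unitary matrix representation) and any lattice representation
`r : LatticeRep G`, the Lie algebra of the compact matrix group `r(G)`, i.e. the real span of
`{X | exp(tX) ∈ r(G) ∀ t ∈ ℝ}`, has positive dimension.

Proof: if the span were `⊥`, von Neumann's exponential chart of `r(G)`
(`Literature.Analysis.Calculus.exists_exp_chart_range`) would show that every `g` with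
`‖r(g) - 1‖_F` small is `g = 1`; so `{1}` is open, hence clopen (`G` is Hausdorff, embedding into
matrices), hence all of the connected `G` — contradicting non-commutativity.
-/

noncomputable section

open NormedSpace

namespace Summit.QuantumFields.YangMills.Theorems.EquipartitionPinsProbe

namespace LiePos

open scoped Matrix.Norms.Frobenius

open Literature.MathematicalPhysics.QuantumFieldTheory

variable {G : Type} [Group G] [TopologicalSpace G] [CompactSpace G]

/-- If every generator of a one-parameter subgroup of `r(G)` vanishes, then every element of `G`
near `1` (in the chart radius of von Neumann's exponential chart) equals `1`: the set
`{g | ‖r(g) - 1‖_F < ε}` is `{1}` for some `ε > 0`. [folklore] -/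
theorem exists_ball_eq_singleton (r : LatticeRep G)
    (h0 : ∀ X : Matrix (Fin r.N) (Fin r.N) ℂ,
      (∀ t : ℝ, exp ((t : ℂ) • X) ∈ Set.range r.ρ) → X = 0) :
    ∃ ε : ℝ, 0 < ε ∧ {g : G | ‖r.ρ g - 1‖ < ε} = {1} := by
  obtain ⟨ε, hε, hchart⟩ :=
    Literature.Analysis.Calculus.exists_exp_chart_range r.ρ r.continuous
  refine ⟨ε, hε, Set.eq_singleton_iff_unique_mem.2 ⟨?_, fun g hg => ?_⟩⟩
  · show ‖r.ρ 1 - 1‖ < ε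
    simpa [map_one] using hε
  · obtain ⟨X, hXmem, hXg, -⟩ := hchart g hg
    have hX : ∀ t : ℝ, exp ((t : ℂ) • X) ∈ Set.range r.ρ := fun t => by
      obtain ⟨k, hk⟩ := hXmem t
      exact ⟨k, hk⟩
    have hX0 : X = 0 := h0 X hX
    apply r.injective
    rw [← hXg, hX0, exp_zero, map_one]

/-- A connected group with a faithful continuous matrix representation whose one-parameter
generators all vanish is commutative (indeed trivial). [folklore] -/
theorem forall_commute_of_generators_eq_zero [ConnectedSpace G] (r : LatticeRep G)
    (h0 : ∀ X : Matrix (Fin r.N) (Fin r.N) ℂ,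
      (∀ t : ℝ, exp ((t : ℂ) • X) ∈ Set.range r.ρ) → X = 0) :
    ∀ a b : G, a * b = b * a := by
  obtain ⟨ε, hε, hball⟩ := exists_ball_eq_singleton r h0
  haveI : T2Space G := T2Space.of_injective_continuous r.injective r.continuous
  have hopen : IsOpen ({1} : Set G) := by
    rw [← hball]
    exact isOpen_lt (continuous_norm.comp (r.continuous.sub continuous_const)) continuous_const
  have hclopen : IsClopen ({1} : Set G) := ⟨isClosed_singleton, hopen⟩
  have huniv : ({1} : Set G) = Set.univ := hclopen.eq_univ (Set.singleton_nonempty 1)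
  have h1 : ∀ g : G, g = 1 := fun g => by
    have hg : g ∈ ({1} : Set G) := huniv ▸ Set.mem_univ g
    simpa using hg
  intro a b
  rw [h1 a, one_mul, mul_one]

end LiePos

/-- **Stub `stub_liePos`**: for a compact simple Lie group `G` and a lattice representation `r`,
the Lie algebra of `r(G)` — the real span of `{X | exp(tX) ∈ r(G) ∀ t}` — has positive real
dimension (von Neumann's exponential chart: a zero Lie algebra would make `{1}` open in the
connected non-abelian `G`). [folklore] -/
theorem stub_liePos :
    ∀ (G : Type) [Group G] [TopologicalSpace G] [IsTopologicalGroup G] [CompactSpace G],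
      Literature.MathematicalPhysics.QuantumFieldTheory.IsCompactSimpleLieGroup G →
      ∀ r : Literature.MathematicalPhysics.QuantumFieldTheory.LatticeRep G,
        0 < Module.finrank ℝ ↥(Submodule.span ℝ {X : Matrix (Fin r.N) (Fin r.N) ℂ |
          ∀ t : ℝ, NormedSpace.exp ((t : ℂ) • X) ∈ Set.range r.ρ}) := by
  intro G _ _ _ _ hG r
  obtain ⟨⟨hconn, ⟨a, b, hab⟩, -⟩, -⟩ := hG
  haveI : ConnectedSpace G := hconn
  refine Nat.pos_of_ne_zero fun h0 => hab ?_
  rw [Submodule.finrank_eq_zero, Submodule.span_eq_bot] at h0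
  exact LiePos.forall_commute_of_generators_eq_zero r (fun X hX => h0 X hX) a b

end Summit.QuantumFields.YangMills.Theorems.EquipartitionPinsProbe

end
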